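import Mathlib
import Literature.Analysis.FluidPDE.Tao2016AveragedNS.ShiftSetCascadeFlows
import Literature.Analysis.ODE.ElementaryFieldChainCertificate
import Summits.NavierStokesRegularity.NavierStokesRegularity.Theorems.TaoLadderRungTwoFlatCertificateGlueTruncFlowOn
import HarnessLib

/-!
# Certificate glue on a shift set `𝕊`, XXI: THE WINDOW FIELD AS A CODE LIST — a computable `FExpr` presentation of
  the weighted truncated window field `QcN` for rational data (shift list, rational table, rational `ε₀`, rational
  weights), with the identification lemma required by glue XX (`stepCert_of_claim`)
  (helper for items stmt-NavierStokesRegularity-22987 `FlatGapCertificatesV2` and stmt-24295 K_A₂(64);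
  cell harvest/h2-tao-ladder, p1 g14)

The tree's verified ODE checkers (`Literature.Analysis.ODE.eChainVerifier`, `eDoubletonChainVerifierS`) take the
vector field as CODE LISTS `Fin n → FExpr n`. This module GENERATES such a code list for the weighted truncated window
field of any table with RATIONAL entries on any shift LIST at a RATIONAL scale parameter `ε₀ = q` with RATIONAL
weights: `windowCodeList`, and proves `fieldFun (windowCodeList …) x = QcN 𝕊 ε₀ α Kb Ka ω x x` (`fieldFun_windowCodeList`)
under `𝕊 = shifts.toFinset`, `α = (↑) ∘ αq`, `ε₀ = q`, `ω = (↑) ∘ ωq`. The clock `(1+q)^{5n/2}` is the code list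
`sqrt (const ((1+q)^(5n)))` (exact for every integer `n`, `eval_clockExpr`), so irrational clocks (`ε₀ = 1/4`: odd shells
carry `√5`) need no extension of the scalar field on the checker side.

HONEST FRAMING: bookkeeping (a computable presentation of a MODEL-lattice polynomial field); nothing certified, no stub
closed, nothing about the Navier–Stokes equations.
-/

noncomputable section

-- the sub-problem namespace repeats the summit name by design (D-0017)
set_option linter.dupNamespace false

namespace Summit.NavierStokesRegularity.NavierStokesRegularity.Theorems

open Set Finset Literature.Analysis.FluidPDE Literature.Analysis.FluidPDE.TaoCascade
open Literature.Analysis.ODE Literature.Analysis.ODE.FExpr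

namespace CertificateGlueOn

variable {m : ℕ} {Kb Ka : ℤ}

/-! ### Building blocks -/

/-- Sum of a list of code lists. [folklore] -/
def sumExpr {N : ℕ} : List (FExpr N) → FExpr N
  | [] => FExpr.const 0
  | a :: l => FExpr.add a (sumExpr l)

/-- Evaluation of `sumExpr`. [folklore] -/
theorem eval_sumExpr {N : ℕ} (l : List (FExpr N)) (x : Fin N → ℝ) :
    (sumExpr l).eval x = (l.map fun a => a.eval x).sum := by
  induction l with
  | nil => simp [sumExpr, FExpr.eval]
  | cons a l ih => simp [sumExpr, FExpr.eval, ih]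

/-- The clock `(1+q)^{5n/2}` as a code list: `√((1+q)^{5n})`. [cite: Tao2016AveragedNS, §4 (4.8) (the clock factor); cell vocabulary] -/
def clockExpr {N : ℕ} (q : ℚ) (n : ℤ) : FExpr N := FExpr.sqrt (FExpr.const ((1 + q) ^ (5 * n)))

/-- Evaluation of the clock code list (`1 + q ≥ 0`). [folklore] -/
theorem eval_clockExpr {N : ℕ} {q : ℚ} (hq : 0 ≤ 1 + (q : ℝ)) (n : ℤ) (x : Fin N → ℝ) :
    (clockExpr (N := N) q n).eval x = (1 + (q : ℝ)) ^ ((5 : ℝ) * n / 2) := by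
  simp only [clockExpr, FExpr.eval]
  push_cast
  rw [Real.sqrt_eq_rpow, ← Real.rpow_intCast, ← Real.rpow_mul hq]
  push_cast
  ring_nf

/-- The index of the window coordinate `(i, n)`. [folklore] -/
def idxOf (Kb Ka : ℤ) (i : Fin m) (n : ℤ) (h : -Kb ≤ n ∧ n ≤ Ka) : Fin (m * winLen Kb Ka) :=
  finProdFinEquiv (i, ⟨(n + Kb).toNat, by unfold winLen; rw [Int.toNat_lt_toNat (by omega)]; omega⟩)

/-- The weighted, truncated coordinate `ω_n · x_{(i,n)}` (zero off the window) as a code list. [folklore] -/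
def coordExpr (Kb Ka : ℤ) (ωq : ℤ → ℚ) (i : Fin m) (n : ℤ) : FExpr (m * winLen Kb Ka) :=
  if h : -Kb ≤ n ∧ n ≤ Ka then FExpr.smul (ωq n) (FExpr.var (idxOf Kb Ka i n h)) else FExpr.const 0

/-- Evaluation of `coordExpr`: the truncated weighted state. [folklore] -/
theorem eval_coordExpr (ωq : ℤ → ℚ) (i : Fin m) (n : ℤ) (x : Fin (m * winLen Kb Ka) → ℝ) :
    (coordExpr Kb Ka ωq i n).eval x =
      truncAt Kb Ka (wstate Kb Ka (fun k => (ωq k : ℝ)) (x ∘ finProdFinEquiv)) i n := by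
  unfold coordExpr truncAt wstate
  split_ifs with h
  · simp only [FExpr.eval, idxOf, Function.comp_apply]
  · simp [FExpr.eval]

/-- One term `α_{i₁i₂i}(μ) · clock(k − μ₃) · ũ_{i₁, k−μ₃+μ₁} · ũ_{i₂, k−μ₃+μ₂}` as a code list. [cite: Tao2016AveragedNS, §4 (4.8); cell vocabulary] -/
def termExpr (Kb Ka : ℤ) (q : ℚ) (ωq : ℤ → ℚ) (αq : Fin m → Fin m → Fin m → ℤ × ℤ × ℤ → ℚ)
    (i : Fin m) (k : ℤ) (i₁ i₂ : Fin m) (μ : ℤ × ℤ × ℤ) : FExpr (m * winLen Kb Ka) :=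
  FExpr.smul (αq i₁ i₂ i μ)
    (FExpr.mul (clockExpr q (k - μ.2.2))
      (FExpr.mul (coordExpr Kb Ka ωq i₁ (k - μ.2.2 + μ.1)) (coordExpr Kb Ka ωq i₂ (k - μ.2.2 + μ.2.1))))

/-- **THE WINDOW FIELD AS A CODE LIST**: coordinate `d ↔ (i, k)` carries
`(1/ω_k) Σ_{i₁,i₂,μ} termExpr`. [cite: Tao2016AveragedNS, §4 (4.8) (the quadratic nonlinearity); cell certificate format, code-list presentation] -/
def windowCodeList (Kb Ka : ℤ) (shifts : List (ℤ × ℤ × ℤ)) (q : ℚ) (ωq : ℤ → ℚ)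
    (αq : Fin m → Fin m → Fin m → ℤ × ℤ × ℤ → ℚ) :
    Fin (m * winLen Kb Ka) → FExpr (m * winLen Kb Ka) := fun d =>
  let ic := finProdFinEquiv.symm d
  let k : ℤ := shellAt Kb ic.2
  FExpr.smul (ωq k)⁻¹
    (sumExpr ((List.finRange m).map fun i₁ => sumExpr ((List.finRange m).map fun i₂ =>
      sumExpr (shifts.map fun μ => termExpr Kb Ka q ωq αq ic.1 k i₁ i₂ μ))))

/-! ### Identification with `QcN` -/

variable {shifts : List (ℤ × ℤ × ℤ)} {q : ℚ} {ωq : ℤ → ℚ} {αq : Fin m → Fin m → Fin m → ℤ × ℤ × ℤ → ℚ}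

/-- Evaluation of one term. [folklore] -/
theorem eval_termExpr (hq : 0 ≤ 1 + (q : ℝ)) (i : Fin m) (k : ℤ) (i₁ i₂ : Fin m) (μ : ℤ × ℤ × ℤ)
    (x : Fin (m * winLen Kb Ka) → ℝ) :
    (termExpr Kb Ka q ωq αq i k i₁ i₂ μ).eval x =
      (αq i₁ i₂ i μ : ℝ) * (1 + (q : ℝ)) ^ ((5 : ℝ) * (k - μ.2.2) / 2) *
        (truncAt Kb Ka (wstate Kb Ka (fun k => (ωq k : ℝ)) (x ∘ finProdFinEquiv)) i₁ (k - μ.2.2 + μ.1) *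
          truncAt Kb Ka (wstate Kb Ka (fun k => (ωq k : ℝ)) (x ∘ finProdFinEquiv)) i₂ (k - μ.2.2 + μ.2.1)) := by
  simp only [termExpr, FExpr.eval, eval_clockExpr hq, eval_coordExpr]
  push_cast
  ring

/-- **`fieldFun (windowCodeList …) = QcN … x x`**: the generated code list evaluates to the weighted truncated window
field, for `𝕊 = shifts.toFinset` (no duplicates), `ε₀ = q`, `α = (↑) ∘ αq`, `ω = (↑) ∘ ωq`.
[cite: Tao2016AveragedNS, §4 (4.8); cell certificate format, code-list presentation] -/
theorem fieldFun_windowCodeList (hq : 0 ≤ 1 + (q : ℝ)) (hnd : shifts.Nodup)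
    (x : Fin (m * winLen Kb Ka) → ℝ) :
    fieldFun (windowCodeList Kb Ka shifts q ωq αq) x =
      QcN shifts.toFinset (q : ℝ) (fun i₁ i₂ i μ => (αq i₁ i₂ i μ : ℝ)) Kb Ka (fun k => (ωq k : ℝ)) x x := by
  funext d
  simp only [fieldFun, windowCodeList, QcN, Qc, wcoord, biFieldOn]
  simp only [FExpr.eval, eval_sumExpr, List.map_map, Function.comp_def, eval_termExpr hq]
  rw [div_eq_inv_mul]
  push_cast
  congr 1
  rw [Fin.sum_univ_def]
  refine congrArg List.sum (List.map_congr_left fun i₁ _ => ?_)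
  rw [Fin.sum_univ_def]
  refine congrArg List.sum (List.map_congr_left fun i₂ _ => ?_)
  rw [List.sum_toFinset _ hnd]

end CertificateGlueOn

end Summit.NavierStokesRegularity.NavierStokesRegularity.Theorems

end
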